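import Mathlib
import HarnessLib
import Summits.HubbardSuperconductivity.HubbardSuperconductivity.Theorems.KLProgrammeC4aTangencyCalculusAll
import Summits.HubbardSuperconductivity.HubbardSuperconductivity.Theorems.KLProgrammeC4aJetComparisonAll
import Summits.HubbardSuperconductivity.HubbardSuperconductivity.Theorems.KLProgrammeC4aPathJetsSix
import Summits.HubbardSuperconductivity.HubbardSuperconductivity.Theorems.KLProgrammeC4aPartnerBandTangencyDefectPh
import Summits.HubbardSuperconductivity.HubbardSuperconductivity.Theorems.KLProgrammeC4aPartnerBandCritical
import Summits.HubbardSuperconductivity.HubbardSuperconductivity.Theorems.KLProgrammeC4aRigidConfigurations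

/-!
# Route `KLProgramme` — crux C4a, S3 brick (B2, TANGENCY, ORDERS ≤ 4, instantiated): every co-moving jet of order `k ≤ 4` of the pp / ph
# partner band AT THE TANGENCY CONFIGURATION is `O(φ²)`; off the configuration it is `O(φ² + |e| + |ρ| + |ϑ − ϑ_T|)` modulo radial rows

Cell `gate-hubbard-kl`, seat hubbard-kl-k3c3-p3 (g23; row «implicit-function / monotonicity route»).  Located brick «(B2)-TAN-ALL» for the
(C)-closer lane hubbard-kl-c4a-1 (stub (C) `stub_twoLeg_curvature` of `KLRegimeEngineV17F2`, stmt-HubbardSuperconductivity-20437; memo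
HOME/hubbard-kl-c4a-1/C4A-PLAN.md §24.8 «Orders 3, 4 at (T) need f ∈ C⁵, C⁶ and Γ-tables D₅, D₆ (frame sizes A₅, A₆)», §24.9 «(B2) STATUS … OPEN:
orders 3–4 at (T) wait for tables msD 5,6 / K₅,K₆»).  The tables are `…C4aPathJetsSix` (`msD6`, `‖Dᵐe_K‖ ≤ 4 + Aₘ`); the calculus is
`…C4aTangencyCalculusAll` / `…C4aJetComparisonAll`.  Binder shape = `…C4aPathJetsSix` (`hA hA20 hd hr hlo hhi hA₃ hA₄ hA₅ hA₆`).

With `T_k(ρ,ϑ,e) := ∂ᵏ_t|₀ e_K(S_{ρ,ϑ,θ}(t) − Φ(e, φ+θ+t))` (pp) and its ph twin `∂ᵏ_t|₀ e_K(Φ(e, φ+θ+t) − D_{ρ,ϑ,θ}(t))`: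
* §1 rows: `norm_iteratedFDeriv_frameLevel_le_frameSum` (`‖Dⁱe_K‖ ≤ 4 + (A + A₃ + A₄ + A₅ + A₆)`, `1 ≤ i ≤ 6`),
  `norm_iteratedDeriv_levelPoint_sub_le_angle_six` (`‖Φ_ρ⁽ⁱ⁾(a) − Φ_ρ⁽ⁱ⁾(b)‖ ≤ msD6 (i+1)·|a − b|`, `i ≤ 5`);
* §2 **`abs_iteratedDeriv_partnerBand_pp_tangency_core_le`** / **`_ph_`** — for EVERY `k ≤ 4`: `|T_k(0,0,0)| ≤ (k+2)!·𝒦·(3𝒟)^{k+2}·φ²` whenever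
  `‖Dⁱe_K‖ ≤ 𝒦` and `msD6 i ≤ 𝒟ⁱ` (`1 ≤ i ≤ k+2`) — UNCONDITIONAL (all inputs landed); `_of_frameSum` variants with `𝒦 = 4 + (A + A₃ + A₄ + A₅ + A₆)`;
* §3 (pp) the reductions at every `k ≤ 4` by the all-orders jet comparison, MODULO RADIAL ROWS
  `‖Φ_x⁽ⁱ⁾ − Φ_0⁽ⁱ⁾‖ ≤ RRᵢ·|x|` for `i ≤ k+1` taken as hypotheses (rows `i ≤ 3` are in the tree: `norm_levelPoint_sub_levelPoint_le`,
  `norm_iteratedDeriv_one/two/three_levelPoint_sub_le`; rows `4, 5` = the named input for `k = 3, 4`):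
  **`abs_iteratedDeriv_partnerBand_pp_sub_level_le`** (`|T_k(ρ,ϑ,e) − T_k(ρ,ϑ,0)| ≤ |e|·(k+1)!·𝒦·D₁^{k+1}`),
  **`abs_iteratedDeriv_partnerBand_pp_sub_config_le`** (`|T_k(ρ,ϑ,0) − T_k(0,0,0)| ≤ (|ρ|+|ϑ|)·(k+1)!·𝒦·D₂^{k+1}`),
  **`abs_iteratedDeriv_partnerBand_pp_tangency_le_of_order`** (the sum of the three).

Proved bookkeeping on landed objects; nothing about the Hubbard model's sizes; nothing asserts superconductivity.
References: FST II = Feldman–Salmhofer–Trubowitz CPAM 51 (1998) §3; BGM 2006 §2.4 Lemma 2.1 (2.40) [cite: BenfattoGiulianiMastropietro2006].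
-/

noncomputable section

namespace Summit.HubbardSuperconductivity.HubbardSuperconductivity.Theorems.C4a

set_option linter.dupNamespace false -- summit = problem name (single-conjunct summit), D-0017

open Real Set Filter
open scoped Topology
open Literature.MathematicalPhysics.QuantumLattice Literature.MathematicalPhysics.QuantumLattice.BandSectorCounting Literature.Probability.LatticeModels
open Summit.HubbardSuperconductivity.HubbardSuperconductivity.Theorems.KLRegimeSplit
open Summit.HubbardSuperconductivity.HubbardSuperconductivity.Theorems.DispersionFlow
open Summit.HubbardSuperconductivity.HubbardSuperconductivity.Theorems.PerturbedFermiCurve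

/-! ## §1 Rows -/

/-- **One constant for the band rows `1 ≤ i ≤ 6`**: `‖Dⁱe_K‖ ≤ 4 + (A + A₃ + A₄ + A₅ + A₆)` (each row is `4 + Aᵢ`, `A₁ = A₂ = A`, and the
frame sizes are nonnegative). -/
theorem norm_iteratedFDeriv_frameLevel_le_frameSum (μ : ℝ) {K : TrigPolyC4v} {A A₃ A₄ A₅ A₆ : ℝ}
    (hA : ∀ p : Momentum, ∀ j ≤ 2, ‖iteratedFDeriv ℝ j (frameShift K) p‖ ≤ A)
    (hA₃ : ∀ p : Momentum, ‖iteratedFDeriv ℝ 3 (frameShift K) p‖ ≤ A₃) (hA₄ : ∀ p : Momentum, ‖iteratedFDeriv ℝ 4 (frameShift K) p‖ ≤ A₄)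
    (hA₅ : ∀ p : Momentum, ‖iteratedFDeriv ℝ 5 (frameShift K) p‖ ≤ A₅) (hA₆ : ∀ p : Momentum, ‖iteratedFDeriv ℝ 6 (frameShift K) p‖ ≤ A₆)
    {i : ℕ} (hi1 : 1 ≤ i) (hi6 : i ≤ 6) (p : Momentum) :
    ‖iteratedFDeriv ℝ i (frameLevel μ K) p‖ ≤ 4 + (A + A₃ + A₄ + A₅ + A₆) := by
  have h0 : 0 ≤ A := (norm_nonneg _).trans (hA 0 0 (by norm_num))
  have h3 : 0 ≤ A₃ := (norm_nonneg _).trans (hA₃ 0)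
  have h4 : 0 ≤ A₄ := (norm_nonneg _).trans (hA₄ 0)
  have h5 : 0 ≤ A₅ := (norm_nonneg _).trans (hA₅ 0)
  have h6 : 0 ≤ A₆ := (norm_nonneg _).trans (hA₆ 0)
  interval_cases i
  · have := norm_iteratedFDeriv_frameLevel_le_four_add μ K (m := 1) le_rfl (fun q => hA q 1 (by norm_num)) p; linarith
  · have := norm_iteratedFDeriv_frameLevel_le_four_add μ K (m := 2) (by norm_num) (fun q => hA q 2 le_rfl) p; linarith
  · have := norm_iteratedFDeriv_frameLevel_le_four_add μ K (m := 3) (by norm_num) hA₃ p; linarith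
  · have := norm_iteratedFDeriv_frameLevel_le_four_add μ K (m := 4) (by norm_num) hA₄ p; linarith
  · have := norm_iteratedFDeriv_frameLevel_le_four_add μ K (m := 5) (by norm_num) hA₅ p; linarith
  · have := norm_iteratedFDeriv_frameLevel_le_four_add μ K (m := 6) (by norm_num) hA₆ p; linarith

section Sizes

variable {K : TrigPolyC4v} {A : ℝ} (hA : ∀ p : Momentum, ∀ j ≤ 2, ‖iteratedFDeriv ℝ j (frameShift K) p‖ ≤ A) (hA20 : A ≤ 1 / 20)
  (hd : klCurveD ≤ (bandBounds (show (-4 : ℝ) < -1.1 by norm_num) (show (-1.1 : ℝ) ≤ -0.1 by norm_num)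
    (show (-0.1 : ℝ) < 0 by norm_num)).Dtmin - 2 * A)
  {μ r : ℝ} (hr : 0 < r) (hlo : (-1.1 : ℝ) < μ - r - A) (hhi : μ + r + A < -0.1)
  {A₃ A₄ A₅ A₆ : ℝ} (hA₃ : ∀ p : Momentum, ‖iteratedFDeriv ℝ 3 (frameShift K) p‖ ≤ A₃)
  (hA₄ : ∀ p : Momentum, ‖iteratedFDeriv ℝ 4 (frameShift K) p‖ ≤ A₄)
  (hA₅ : ∀ p : Momentum, ‖iteratedFDeriv ℝ 5 (frameShift K) p‖ ≤ A₅)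
  (hA₆ : ∀ p : Momentum, ‖iteratedFDeriv ℝ 6 (frameShift K) p‖ ≤ A₆)
include hA hA20 hd hr hlo hhi hA₃ hA₄ hA₅ hA₆

omit hr in
/-- **Angle-Lipschitz rows to order five**: `‖Φ_ρ⁽ⁱ⁾(a) − Φ_ρ⁽ⁱ⁾(b)‖ ≤ msD6 A₃ A₄ A₅ A₆ (i+1)·|a − b|` for `i ≤ 5`, `|ρ| < r` (mean value with the
next row of the extended table). -/
theorem norm_iteratedDeriv_levelPoint_sub_le_angle_six {ρ : ℝ} (hρ : |ρ| < r) {i : ℕ} (hi : i ≤ 5) (a b : ℝ) :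
    ‖iteratedDeriv i (levelPoint μ K ρ) a - iteratedDeriv i (levelPoint μ K ρ) b‖ ≤ msD6 A₃ A₄ A₅ A₆ (i + 1) * |a - b| := by
  have hc : ContDiff ℝ (i + 1 : ℕ) (levelPoint μ K ρ) := contDiff_levelPoint_of_sizes hA hd hlo hhi hρ (i + 1)
  have hdiff : Differentiable ℝ (iteratedDeriv i (levelPoint μ K ρ)) := hc.differentiable_iteratedDeriv i (by exact_mod_cast lt_add_one i)
  have hbound : ∀ x ∈ (univ : Set ℝ), ‖deriv (iteratedDeriv i (levelPoint μ K ρ)) x‖ ≤ msD6 A₃ A₄ A₅ A₆ (i + 1) := fun x _ => by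
    rw [← iteratedDeriv_succ]
    exact norm_iteratedDeriv_levelPoint_le_six hA hA20 hd hlo hhi hA₃ hA₄ hA₅ hA₆ hρ (by omega) (by omega) x
  have h := (convex_univ (𝕜 := ℝ) (E := ℝ)).norm_image_sub_le_of_norm_deriv_le (fun x _ => hdiff x) hbound (mem_univ b) (mem_univ a)
  rwa [Real.norm_eq_abs] at h

/-! ## §2 The tangency core of the pp / ph partner band at every order `k ≤ 4` -/

/-- **THE `k`-TH CO-MOVING JET OF THE pp PARTNER BAND AT THE TANGENCY CONFIGURATION**, loop on the Fermi curve, `k ≤ 4`: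
`|∂ᵏ_t|₀ e_K(S_{0,0,θ}(t) − Φ(0, φ+θ+t))| ≤ (k+2)!·𝒦·(3𝒟)^{k+2}·φ²` for any `𝒦` dominating the band rows `‖Dⁱe_K‖` and any `𝒟` with
`msD6 i ≤ 𝒟ⁱ` (`1 ≤ i ≤ k+2`).  [FST II §3 mechanism; the located orders are `k = 3, 4`] -/
theorem abs_iteratedDeriv_partnerBand_pp_tangency_core_le {k : ℕ} (hk : k ≤ 4) {𝒦 𝒟 : ℝ}
    (hK : ∀ i, 1 ≤ i → i ≤ k + 2 → ∀ p : Momentum, ‖iteratedFDeriv ℝ i (frameLevel μ K) p‖ ≤ 𝒦)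
    (hD : ∀ i, 1 ≤ i → i ≤ k + 2 → msD6 A₃ A₄ A₅ A₆ i ≤ 𝒟 ^ i) (θ φ : ℝ) :
    |iteratedDeriv k (fun t : ℝ => frameLevel μ K (pairSumPath μ K 0 0 θ t - levelPoint μ K 0 (φ + θ + t))) 0| ≤
      (k + 2).factorial * 𝒦 * (3 * 𝒟) ^ (k + 2) * φ ^ 2 := by
  set B₀ := bandBounds (show (-4 : ℝ) < -1.1 by norm_num) (show (-1.1 : ℝ) ≤ -0.1 by norm_num) (show (-0.1 : ℝ) < 0 by norm_num) with hB₀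
  have h0 : |(0 : ℝ)| < r := by simpa using hr
  have hfun : (fun t : ℝ => frameLevel μ K (pairSumPath μ K 0 0 θ t - levelPoint μ K 0 (φ + θ + t))) = fun t : ℝ =>
      frameLevel μ K (levelPoint μ K 0 (θ + t) + levelPoint μ K 0 (θ + t) - levelPoint μ K 0 (φ + θ + t)) := by
    funext t; simp only [pairSumPath, zero_add]
  rw [hfun]
  exact abs_iteratedDeriv_tangency_core_le_of_order (EngineV8.contDiff_frameLevel μ K (n := (k + 2 : ℕ))) le_rfl hK
    (contDiff_levelPoint_of_sizes hA hd hlo hhi h0 (k + 2)) (fun s => frameLevel_levelPoint_zero B₀ hA hr hlo hhi s)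
    (fun i hi1 hi2 s => (norm_iteratedDeriv_levelPoint_le_six hA hA20 hd hlo hhi hA₃ hA₄ hA₅ hA₆ h0 hi1 (by omega) s).trans (hD i hi1 hi2)) θ φ

/-- **The ph twin at the `2k_F` configuration `(0, π)`**: `|∂ᵏ_t|₀ e_K(Φ(0, φ+θ+t) − D_{0,π,θ}(t))| ≤ (k+2)!·𝒦·(3𝒟)^{k+2}·φ²` (`k ≤ 4`) — the ph
partner band there is `e_K(−(2Φ(0,θ+t) − Φ(0,φ+θ+t)))`, the pp one by evenness of `e_K`. -/
theorem abs_iteratedDeriv_partnerBand_ph_tangency_core_le {k : ℕ} (hk : k ≤ 4) {𝒦 𝒟 : ℝ}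
    (hK : ∀ i, 1 ≤ i → i ≤ k + 2 → ∀ p : Momentum, ‖iteratedFDeriv ℝ i (frameLevel μ K) p‖ ≤ 𝒦)
    (hD : ∀ i, 1 ≤ i → i ≤ k + 2 → msD6 A₃ A₄ A₅ A₆ i ≤ 𝒟 ^ i) (θ φ : ℝ) :
    |iteratedDeriv k (fun t : ℝ => frameLevel μ K (levelPoint μ K 0 (φ + θ + t) - pairDiffPath μ K 0 π θ t)) 0| ≤
      (k + 2).factorial * 𝒦 * (3 * 𝒟) ^ (k + 2) * φ ^ 2 := by
  have hfun : (fun t : ℝ => frameLevel μ K (levelPoint μ K 0 (φ + θ + t) - pairDiffPath μ K 0 π θ t)) = fun t : ℝ =>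
      frameLevel μ K (pairSumPath μ K 0 0 θ t - levelPoint μ K 0 (φ + θ + t)) := by
    funext t
    rw [← frameLevel_neg μ K (pairSumPath μ K 0 0 θ t - levelPoint μ K 0 (φ + θ + t))]
    congr 1
    simp only [pairDiffPath, pairSumPath, zero_add]
    rw [show π + θ + t = (θ + t) + π by ring, levelPoint_add_pi]
    abel
  rw [hfun]
  exact abs_iteratedDeriv_partnerBand_pp_tangency_core_le hA hA20 hd hr hlo hhi hA₃ hA₄ hA₅ hA₆ hk hK hD θ φ

/-- **pp tangency core with the band rows discharged**: `𝒦 = 4 + (A + A₃ + A₄ + A₅ + A₆)`. -/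
theorem abs_iteratedDeriv_partnerBand_pp_tangency_core_le_of_frameSum {k : ℕ} (hk : k ≤ 4) {𝒟 : ℝ}
    (hD : ∀ i, 1 ≤ i → i ≤ k + 2 → msD6 A₃ A₄ A₅ A₆ i ≤ 𝒟 ^ i) (θ φ : ℝ) :
    |iteratedDeriv k (fun t : ℝ => frameLevel μ K (pairSumPath μ K 0 0 θ t - levelPoint μ K 0 (φ + θ + t))) 0| ≤
      (k + 2).factorial * (4 + (A + A₃ + A₄ + A₅ + A₆)) * (3 * 𝒟) ^ (k + 2) * φ ^ 2 :=
  abs_iteratedDeriv_partnerBand_pp_tangency_core_le hA hA20 hd hr hlo hhi hA₃ hA₄ hA₅ hA₆ hk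
    (fun i hi1 hi2 p => norm_iteratedFDeriv_frameLevel_le_frameSum μ hA hA₃ hA₄ hA₅ hA₆ hi1 (by omega) p) hD θ φ

/-- **ph tangency core with the band rows discharged**: `𝒦 = 4 + (A + A₃ + A₄ + A₅ + A₆)`. -/
theorem abs_iteratedDeriv_partnerBand_ph_tangency_core_le_of_frameSum {k : ℕ} (hk : k ≤ 4) {𝒟 : ℝ}
    (hD : ∀ i, 1 ≤ i → i ≤ k + 2 → msD6 A₃ A₄ A₅ A₆ i ≤ 𝒟 ^ i) (θ φ : ℝ) :
    |iteratedDeriv k (fun t : ℝ => frameLevel μ K (levelPoint μ K 0 (φ + θ + t) - pairDiffPath μ K 0 π θ t)) 0| ≤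
      (k + 2).factorial * (4 + (A + A₃ + A₄ + A₅ + A₆)) * (3 * 𝒟) ^ (k + 2) * φ ^ 2 :=
  abs_iteratedDeriv_partnerBand_ph_tangency_core_le hA hA20 hd hr hlo hhi hA₃ hA₄ hA₅ hA₆ hk
    (fun i hi1 hi2 p => norm_iteratedFDeriv_frameLevel_le_frameSum μ hA hA₃ hA₄ hA₅ hA₆ hi1 (by omega) p) hD θ φ

/-! ## §3 Off the tangency configuration (pp): the reductions `e → 0` and `(ρ, ϑ) → (0, 0)` at every order `k ≤ 4`, modulo radial rows -/

omit hA20 hA₃ hA₄ hA₅ hA₆ in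
/-- Jets at `t = 0` of the pp comparison path `X(t) = S_{ρ,ϑ,θ}(t) − Φ(x, φ+θ+t)` are the curve jets. -/
theorem iteratedDeriv_pairSumPath_sub_levelPoint_zero {ρ x : ℝ} (hρ : |ρ| < r) (hx : |x| < r) (ϑ θ φ : ℝ) (j : ℕ) :
    iteratedDeriv j (fun t : ℝ => pairSumPath μ K ρ ϑ θ t - levelPoint μ K x (φ + θ + t)) 0 =
      iteratedDeriv j (levelPoint μ K 0) θ + iteratedDeriv j (levelPoint μ K ρ) (ϑ + θ) - iteratedDeriv j (levelPoint μ K x) (φ + θ) := by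
  set B₀ := bandBounds (show (-4 : ℝ) < -1.1 by norm_num) (show (-1.1 : ℝ) ≤ -0.1 by norm_num) (show (-0.1 : ℝ) < 0 by norm_num) with hB₀
  have hADt : 2 * A < B₀.Dtmin := by have := klCurveD_pos; linarith
  have hS : ContDiff ℝ j (pairSumPath μ K ρ ϑ θ) := contDiff_pairSumPath B₀ hA hADt hr hlo hhi hρ ϑ θ
  have hγ : ContDiff ℝ j (fun t : ℝ => levelPoint μ K x (φ + θ + t)) :=
    (contDiff_levelPoint_of_sizes hA hd hlo hhi hx j).comp (contDiff_const.add contDiff_id)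
  rw [iteratedDeriv_fun_sub hS.contDiffAt hγ.contDiffAt, iteratedDeriv_pairSumPath_zero hA hd hr hlo hhi hρ ϑ θ j,
    iteratedDeriv_comp_const_add (f := levelPoint μ K x)]
  simp only [add_zero]

omit hA20 hA₃ hA₄ hA₅ hA₆ hr in
/-- Jets at `t = 0` of a difference of two shifted level curves: `∂ʲ_t|₀ (Φ(x, c+t) − Φ(y, c+t)) = Φ_x⁽ʲ⁾(c) − Φ_y⁽ʲ⁾(c)`. -/
theorem iteratedDeriv_levelPoint_sub_levelPoint_shift_zero {x y : ℝ} (hx : |x| < r) (hy : |y| < r) (c : ℝ) (j : ℕ) :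
    iteratedDeriv j (fun t : ℝ => levelPoint μ K x (c + t) - levelPoint μ K y (c + t)) 0 =
      iteratedDeriv j (levelPoint μ K x) c - iteratedDeriv j (levelPoint μ K y) c := by
  have h1 : ContDiff ℝ j (fun t : ℝ => levelPoint μ K x (c + t)) := (contDiff_levelPoint_of_sizes hA hd hlo hhi hx j).comp (contDiff_const.add contDiff_id)
  have h2 : ContDiff ℝ j (fun t : ℝ => levelPoint μ K y (c + t)) := (contDiff_levelPoint_of_sizes hA hd hlo hhi hy j).comp (contDiff_const.add contDiff_id)
  rw [iteratedDeriv_fun_sub h1.contDiffAt h2.contDiffAt, iteratedDeriv_comp_const_add (f := levelPoint μ K x),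
    iteratedDeriv_comp_const_add (f := levelPoint μ K y)]
  simp only [add_zero]

/-- **REDUCTION `e → 0` AT ORDER `k ≤ 4` (pp)**: given radial rows `‖Φ_e⁽ⁱ⁾ − Φ_0⁽ⁱ⁾‖ ≤ RRᵢ·|e|` for `i ≤ k+1` and a base `D` with
`3·msD6 i + |e|·RRᵢ + i·RRᵢ₋₁ ≤ Dⁱ` (`1 ≤ i ≤ k+1`):  `|T_k(ρ,ϑ,e) − T_k(ρ,ϑ,0)| ≤ |e|·(k+1)!·𝒦·D^{k+1}`. -/
theorem abs_iteratedDeriv_partnerBand_pp_sub_level_le {k : ℕ} (hk : k ≤ 4) {𝒦 : ℝ}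
    (hK : ∀ i, 1 ≤ i → i ≤ k + 1 → ∀ p : Momentum, ‖iteratedFDeriv ℝ i (frameLevel μ K) p‖ ≤ 𝒦)
    {ρ : ℝ} (hρ : |ρ| < r) {e : ℝ} (he : |e| < r) {RR : ℕ → ℝ}
    (hRR : ∀ i, i ≤ k + 1 → ∀ s, ‖iteratedDeriv i (levelPoint μ K e) s - iteratedDeriv i (levelPoint μ K 0) s‖ ≤ RR i * |e|)
    {D : ℝ} (hDrow : ∀ i, 1 ≤ i → i ≤ k + 1 → 3 * msD6 A₃ A₄ A₅ A₆ i + |e| * RR i + i * RR (i - 1) ≤ D ^ i) (ϑ θ φ : ℝ) :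
    |iteratedDeriv k (fun t : ℝ => frameLevel μ K (pairSumPath μ K ρ ϑ θ t - levelPoint μ K e (φ + θ + t))) 0 -
      iteratedDeriv k (fun t : ℝ => frameLevel μ K (pairSumPath μ K ρ ϑ θ t - levelPoint μ K 0 (φ + θ + t))) 0| ≤
      |e| * ((k + 1).factorial * 𝒦 * D ^ (k + 1)) := by
  set B₀ := bandBounds (show (-4 : ℝ) < -1.1 by norm_num) (show (-1.1 : ℝ) ≤ -0.1 by norm_num) (show (-0.1 : ℝ) < 0 by norm_num) with hB₀
  have hADt : 2 * A < B₀.Dtmin := by have := klCurveD_pos; linarith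
  have h0 : |(0 : ℝ)| < r := by simpa using hr
  by_cases he0 : e = 0
  · subst he0; simp
  -- the comparison path and the rescaled perturbation
  set X : ℝ → Momentum := fun t => pairSumPath μ K ρ ϑ θ t - levelPoint μ K 0 (φ + θ + t) with hX
  set G : ℝ → Momentum := fun t => levelPoint μ K 0 (φ + θ + t) - levelPoint μ K e (φ + θ + t) with hG
  set Δ : ℝ → Momentum := e⁻¹ • G with hΔ
  have hXc : ContDiff ℝ (k + 1 : ℕ) X := (contDiff_pairSumPath B₀ hA hADt hr hlo hhi hρ ϑ θ).sub
    ((contDiff_levelPoint_of_sizes hA hd hlo hhi h0 (k + 1)).comp (contDiff_const.add contDiff_id))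
  have hGc : ContDiff ℝ (k + 1 : ℕ) G := ((contDiff_levelPoint_of_sizes hA hd hlo hhi h0 (k + 1)).comp (contDiff_const.add contDiff_id)).sub
    ((contDiff_levelPoint_of_sizes hA hd hlo hhi he (k + 1)).comp (contDiff_const.add contDiff_id))
  have hΔc : ContDiff ℝ (k + 1 : ℕ) Δ := hGc.const_smul e⁻¹
  have hfun : (fun t : ℝ => frameLevel μ K (pairSumPath μ K ρ ϑ θ t - levelPoint μ K e (φ + θ + t))) =
      fun t : ℝ => frameLevel μ K (X t + e • Δ t) := by
    funext t
    simp only [hX, hG, hΔ, Pi.smul_apply, smul_smul, mul_inv_cancel₀ he0, one_smul]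
    congr 1; abel
  have hfun0 : (fun t : ℝ => frameLevel μ K (pairSumPath μ K ρ ϑ θ t - levelPoint μ K 0 (φ + θ + t))) =
      fun t : ℝ => frameLevel μ K (X t) := rfl
  rw [hfun, hfun0]
  refine abs_iteratedDeriv_comp_add_smul_sub_le (EngineV8.contDiff_frameLevel μ K (n := (k + 1 : ℕ))) le_rfl hK hXc hΔc e
    (fun i hi1 hi => le_trans ?_ (hDrow i hi1 hi))
  -- the jets at `t = 0`
  have hXj : ‖iteratedDeriv i X 0‖ ≤ 3 * msD6 A₃ A₄ A₅ A₆ i := by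
    rw [hX, iteratedDeriv_pairSumPath_sub_levelPoint_zero hA hd hr hlo hhi hρ h0 ϑ θ φ i]
    have h1 := norm_iteratedDeriv_levelPoint_le_six hA hA20 hd hlo hhi hA₃ hA₄ hA₅ hA₆ h0 hi1 (by omega) θ
    have h2 := norm_iteratedDeriv_levelPoint_le_six hA hA20 hd hlo hhi hA₃ hA₄ hA₅ hA₆ hρ hi1 (by omega) (ϑ + θ)
    have h3 := norm_iteratedDeriv_levelPoint_le_six hA hA20 hd hlo hhi hA₃ hA₄ hA₅ hA₆ h0 hi1 (by omega) (φ + θ)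
    have := norm_sub_le (iteratedDeriv i (levelPoint μ K 0) θ + iteratedDeriv i (levelPoint μ K ρ) (ϑ + θ)) (iteratedDeriv i (levelPoint μ K 0) (φ + θ))
    have := norm_add_le (iteratedDeriv i (levelPoint μ K 0) θ) (iteratedDeriv i (levelPoint μ K ρ) (ϑ + θ))
    linarith
  have hΔj : ∀ j, j ≤ k + 1 → ‖iteratedDeriv j Δ 0‖ ≤ RR j := fun j hj => by
    have hGj : ContDiffAt ℝ j G 0 := (hGc.of_le (by exact_mod_cast hj)).contDiffAt
    rw [hΔ, iteratedDeriv_const_smul hGj, hG, iteratedDeriv_levelPoint_sub_levelPoint_shift_zero hA hd hlo hhi h0 he (φ + θ) j,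
      norm_smul, norm_inv, Real.norm_eq_abs, ← norm_neg, neg_sub]
    have h := hRR j hj (φ + θ)
    have hepos : 0 < |e| := abs_pos.2 he0
    rw [inv_mul_le_iff₀ hepos, mul_comm]
    exact h
  have t1 := hΔj i hi
  have t2 := hΔj (i - 1) (by omega)
  have hi0 : (0 : ℝ) ≤ i := Nat.cast_nonneg i
  nlinarith [abs_nonneg e, mul_le_mul_of_nonneg_left t1 (abs_nonneg e), mul_le_mul_of_nonneg_left t2 hi0]

/-- **REDUCTION `(ρ, ϑ) → (0, 0)` AT ORDER `k ≤ 4` (pp, loop on the Fermi curve)**: given nonnegative radial rows `‖Φ_ρ⁽ⁱ⁾ − Φ_0⁽ⁱ⁾‖ ≤ RRᵢ·|ρ|`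
for `i ≤ k+1` and a base `D` with `3·msD6 i + (|ρ|+|ϑ|)·(RRᵢ + msD6 (i+1)) + i·(RRᵢ₋₁ + msD6 i) ≤ Dⁱ` (`1 ≤ i ≤ k+1`):
`|T_k(ρ,ϑ,0) − T_k(0,0,0)| ≤ (|ρ| + |ϑ|)·(k+1)!·𝒦·D^{k+1}` (the `ϑ`-rows are the extended curve table, by the mean value theorem). -/
theorem abs_iteratedDeriv_partnerBand_pp_sub_config_le {k : ℕ} (hk : k ≤ 4) {𝒦 : ℝ}
    (hK : ∀ i, 1 ≤ i → i ≤ k + 1 → ∀ p : Momentum, ‖iteratedFDeriv ℝ i (frameLevel μ K) p‖ ≤ 𝒦)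
    {ρ : ℝ} (hρ : |ρ| < r) {RR : ℕ → ℝ} (hRR0 : ∀ i, i ≤ k + 1 → 0 ≤ RR i)
    (hRR : ∀ i, i ≤ k + 1 → ∀ s, ‖iteratedDeriv i (levelPoint μ K ρ) s - iteratedDeriv i (levelPoint μ K 0) s‖ ≤ RR i * |ρ|)
    (ϑ : ℝ) {D : ℝ} (hDrow : ∀ i, 1 ≤ i → i ≤ k + 1 →
      3 * msD6 A₃ A₄ A₅ A₆ i + (|ρ| + |ϑ|) * (RR i + msD6 A₃ A₄ A₅ A₆ (i + 1)) + i * (RR (i - 1) + msD6 A₃ A₄ A₅ A₆ i) ≤ D ^ i) (θ φ : ℝ) :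
    |iteratedDeriv k (fun t : ℝ => frameLevel μ K (pairSumPath μ K ρ ϑ θ t - levelPoint μ K 0 (φ + θ + t))) 0 -
      iteratedDeriv k (fun t : ℝ => frameLevel μ K (pairSumPath μ K 0 0 θ t - levelPoint μ K 0 (φ + θ + t))) 0| ≤
      (|ρ| + |ϑ|) * ((k + 1).factorial * 𝒦 * D ^ (k + 1)) := by
  set B₀ := bandBounds (show (-4 : ℝ) < -1.1 by norm_num) (show (-1.1 : ℝ) ≤ -0.1 by norm_num) (show (-0.1 : ℝ) < 0 by norm_num) with hB₀
  have hADt : 2 * A < B₀.Dtmin := by have := klCurveD_pos; linarith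
  have h0 : |(0 : ℝ)| < r := by simpa using hr
  set δ : ℝ := |ρ| + |ϑ| with hδ
  have hδ0 : 0 ≤ δ := add_nonneg (abs_nonneg ρ) (abs_nonneg ϑ)
  by_cases hδz : δ = 0
  · have hρ0 : ρ = 0 := abs_eq_zero.1 (by linarith [abs_nonneg ρ, abs_nonneg ϑ])
    have hϑ0 : ϑ = 0 := abs_eq_zero.1 (by linarith [abs_nonneg ρ, abs_nonneg ϑ])
    subst hρ0; subst hϑ0
    rw [hδz, sub_self, abs_zero, zero_mul]
  have hδpos : 0 < δ := lt_of_le_of_ne hδ0 (Ne.symm hδz)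
  -- the comparison path and the rescaled perturbation
  set X : ℝ → Momentum := fun t => pairSumPath μ K 0 0 θ t - levelPoint μ K 0 (φ + θ + t) with hX
  set G : ℝ → Momentum := fun t => levelPoint μ K ρ (ϑ + θ + t) - levelPoint μ K 0 (θ + t) with hG
  set Δ : ℝ → Momentum := δ⁻¹ • G with hΔ
  have hXc : ContDiff ℝ (k + 1 : ℕ) X := (contDiff_pairSumPath B₀ hA hADt hr hlo hhi h0 0 θ).sub
    ((contDiff_levelPoint_of_sizes hA hd hlo hhi h0 (k + 1)).comp (contDiff_const.add contDiff_id))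
  have hGc : ContDiff ℝ (k + 1 : ℕ) G := ((contDiff_levelPoint_of_sizes hA hd hlo hhi hρ (k + 1)).comp (contDiff_const.add contDiff_id)).sub
    ((contDiff_levelPoint_of_sizes hA hd hlo hhi h0 (k + 1)).comp (contDiff_const.add contDiff_id))
  have hΔc : ContDiff ℝ (k + 1 : ℕ) Δ := hGc.const_smul δ⁻¹
  have hfun : (fun t : ℝ => frameLevel μ K (pairSumPath μ K ρ ϑ θ t - levelPoint μ K 0 (φ + θ + t))) =
      fun t : ℝ => frameLevel μ K (X t + δ • Δ t) := by
    funext t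
    simp only [hX, hG, hΔ, Pi.smul_apply, smul_smul, mul_inv_cancel₀ hδz, one_smul, pairSumPath, zero_add]
    congr 1; abel
  have hfun0 : (fun t : ℝ => frameLevel μ K (pairSumPath μ K 0 0 θ t - levelPoint μ K 0 (φ + θ + t))) =
      fun t : ℝ => frameLevel μ K (X t) := rfl
  rw [hfun, hfun0]
  have hcmp := abs_iteratedDeriv_comp_add_smul_sub_le (EngineV8.contDiff_frameLevel μ K (n := (k + 1 : ℕ))) le_rfl hK hXc hΔc δ
    (D := D) (fun i hi1 hi => le_trans ?_ (hDrow i hi1 hi))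
  · rwa [abs_of_nonneg hδ0] at hcmp
  -- the jets at `t = 0`
  have hXj : ‖iteratedDeriv i X 0‖ ≤ 3 * msD6 A₃ A₄ A₅ A₆ i := by
    rw [hX, iteratedDeriv_pairSumPath_sub_levelPoint_zero hA hd hr hlo hhi h0 h0 0 θ φ i]
    have h1 := norm_iteratedDeriv_levelPoint_le_six hA hA20 hd hlo hhi hA₃ hA₄ hA₅ hA₆ h0 hi1 (by omega) θ
    have h2 := norm_iteratedDeriv_levelPoint_le_six hA hA20 hd hlo hhi hA₃ hA₄ hA₅ hA₆ h0 hi1 (by omega) (0 + θ)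
    have h3 := norm_iteratedDeriv_levelPoint_le_six hA hA20 hd hlo hhi hA₃ hA₄ hA₅ hA₆ h0 hi1 (by omega) (φ + θ)
    have := norm_sub_le (iteratedDeriv i (levelPoint μ K 0) θ + iteratedDeriv i (levelPoint μ K 0) (0 + θ)) (iteratedDeriv i (levelPoint μ K 0) (φ + θ))
    have := norm_add_le (iteratedDeriv i (levelPoint μ K 0) θ) (iteratedDeriv i (levelPoint μ K 0) (0 + θ))
    linarith
  -- `‖G⁽ʲ⁾(0)‖ ≤ RRⱼ|ρ| + msD6 (j+1)|ϑ|`, hence `‖Δ⁽ʲ⁾(0)‖ ≤ RRⱼ + msD6 (j+1)`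
  have hGj : ∀ j, j ≤ k + 1 → ‖iteratedDeriv j G 0‖ ≤ RR j * |ρ| + msD6 A₃ A₄ A₅ A₆ (j + 1) * |ϑ| := fun j hj => by
    have h1 : ContDiff ℝ j (fun t : ℝ => levelPoint μ K ρ (ϑ + θ + t)) := (contDiff_levelPoint_of_sizes hA hd hlo hhi hρ j).comp (contDiff_const.add contDiff_id)
    have h2 : ContDiff ℝ j (fun t : ℝ => levelPoint μ K 0 (θ + t)) := (contDiff_levelPoint_of_sizes hA hd hlo hhi h0 j).comp (contDiff_const.add contDiff_id)
    rw [hG, iteratedDeriv_fun_sub h1.contDiffAt h2.contDiffAt, iteratedDeriv_comp_const_add (f := levelPoint μ K ρ),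
      iteratedDeriv_comp_const_add (f := levelPoint μ K 0)]
    simp only [add_zero]
    have e1 : iteratedDeriv j (levelPoint μ K ρ) (ϑ + θ) - iteratedDeriv j (levelPoint μ K 0) θ =
        (iteratedDeriv j (levelPoint μ K ρ) (ϑ + θ) - iteratedDeriv j (levelPoint μ K 0) (ϑ + θ)) +
        (iteratedDeriv j (levelPoint μ K 0) (ϑ + θ) - iteratedDeriv j (levelPoint μ K 0) θ) := by abel
    rw [e1]
    refine (norm_add_le _ _).trans (add_le_add (hRR j hj (ϑ + θ)) ?_)
    have h := norm_iteratedDeriv_levelPoint_sub_le_angle_six hA hA20 hd hlo hhi hA₃ hA₄ hA₅ hA₆ h0 (by omega : j ≤ 5) (ϑ + θ) θ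
    rwa [show ϑ + θ - θ = ϑ by ring] at h
  have hΔj : ∀ j, j ≤ k + 1 → ‖iteratedDeriv j Δ 0‖ ≤ RR j + msD6 A₃ A₄ A₅ A₆ (j + 1) := fun j hj => by
    have hGjc : ContDiffAt ℝ j G 0 := (hGc.of_le (by exact_mod_cast hj)).contDiffAt
    rw [hΔ, iteratedDeriv_const_smul hGjc, norm_smul, norm_inv, Real.norm_eq_abs, abs_of_pos hδpos, inv_mul_le_iff₀ hδpos]
    refine (hGj j hj).trans ?_
    have hM : 0 ≤ msD6 A₃ A₄ A₅ A₆ (j + 1) := msD6_nonneg hA hA20 hd hlo hhi hA₃ hA₄ hA₅ hA₆ (by omega) (by omega) h0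
    have hR := hRR0 j hj
    rw [hδ]
    nlinarith [abs_nonneg ρ, abs_nonneg ϑ]
  have t1 := hΔj i hi
  have t2 := hΔj (i - 1) (by omega)
  have hi0 : (0 : ℝ) ≤ i := Nat.cast_nonneg i
  have hsub : (i - 1 + 1 : ℕ) = i := by omega
  rw [hsub] at t2
  rw [abs_of_nonneg hδ0]
  nlinarith [mul_le_mul_of_nonneg_left t1 hδ0, mul_le_mul_of_nonneg_left t2 hi0]

/-- **THE `k`-TH CO-MOVING JET OF THE pp PARTNER BAND NEAR TANGENCY, `k ≤ 4`** — core + the two reductions: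
`|T_k(ρ,ϑ,e)| ≤ (k+2)!·𝒦·(3𝒟)^{k+2}·φ² + |e|·(k+1)!·𝒦·D₁^{k+1} + (|ρ|+|ϑ|)·(k+1)!·𝒦·D₂^{k+1}` — quadratic vanishing in the loop angle, linear in the
loop level and in the distance to the tangency configuration, at EVERY order `k ≤ 4`, modulo the radial rows `RRᵢ` (`i ≤ k+1`; in the tree for
`i ≤ 3`).  This is the located order-3/4 input of C4A-PLAN §24.4's power counting near (T). -/
theorem abs_iteratedDeriv_partnerBand_pp_tangency_le_of_order {k : ℕ} (hk : k ≤ 4) {𝒦 𝒟 : ℝ}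
    (hK : ∀ i, 1 ≤ i → i ≤ k + 2 → ∀ p : Momentum, ‖iteratedFDeriv ℝ i (frameLevel μ K) p‖ ≤ 𝒦)
    (hD : ∀ i, 1 ≤ i → i ≤ k + 2 → msD6 A₃ A₄ A₅ A₆ i ≤ 𝒟 ^ i)
    {ρ : ℝ} (hρ : |ρ| < r) {e : ℝ} (he : |e| < r) {RR : ℕ → ℝ} (hRR0 : ∀ i, i ≤ k + 1 → 0 ≤ RR i)
    (hRRe : ∀ i, i ≤ k + 1 → ∀ s, ‖iteratedDeriv i (levelPoint μ K e) s - iteratedDeriv i (levelPoint μ K 0) s‖ ≤ RR i * |e|)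
    (hRRρ : ∀ i, i ≤ k + 1 → ∀ s, ‖iteratedDeriv i (levelPoint μ K ρ) s - iteratedDeriv i (levelPoint μ K 0) s‖ ≤ RR i * |ρ|)
    (ϑ : ℝ) {D₁ D₂ : ℝ} (hD₁ : ∀ i, 1 ≤ i → i ≤ k + 1 → 3 * msD6 A₃ A₄ A₅ A₆ i + |e| * RR i + i * RR (i - 1) ≤ D₁ ^ i)
    (hD₂ : ∀ i, 1 ≤ i → i ≤ k + 1 →
      3 * msD6 A₃ A₄ A₅ A₆ i + (|ρ| + |ϑ|) * (RR i + msD6 A₃ A₄ A₅ A₆ (i + 1)) + i * (RR (i - 1) + msD6 A₃ A₄ A₅ A₆ i) ≤ D₂ ^ i) (θ φ : ℝ) :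
    |iteratedDeriv k (fun t : ℝ => frameLevel μ K (pairSumPath μ K ρ ϑ θ t - levelPoint μ K e (φ + θ + t))) 0| ≤
      (k + 2).factorial * 𝒦 * (3 * 𝒟) ^ (k + 2) * φ ^ 2 + |e| * ((k + 1).factorial * 𝒦 * D₁ ^ (k + 1)) +
        (|ρ| + |ϑ|) * ((k + 1).factorial * 𝒦 * D₂ ^ (k + 1)) := by
  have hK1 : ∀ i, 1 ≤ i → i ≤ k + 1 → ∀ p : Momentum, ‖iteratedFDeriv ℝ i (frameLevel μ K) p‖ ≤ 𝒦 := fun i hi1 hi p => hK i hi1 (by omega) p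
  have step1 := abs_iteratedDeriv_partnerBand_pp_sub_level_le hA hA20 hd hr hlo hhi hA₃ hA₄ hA₅ hA₆ hk hK1 hρ he hRRe hD₁ ϑ θ φ
  have step2 := abs_iteratedDeriv_partnerBand_pp_sub_config_le hA hA20 hd hr hlo hhi hA₃ hA₄ hA₅ hA₆ hk hK1 hρ hRR0 hRRρ ϑ hD₂ θ φ
  have step3 := abs_iteratedDeriv_partnerBand_pp_tangency_core_le hA hA20 hd hr hlo hhi hA₃ hA₄ hA₅ hA₆ hk hK hD θ φ
  have tri := abs_sub_abs_le_abs_sub (iteratedDeriv k (fun t : ℝ => frameLevel μ K (pairSumPath μ K ρ ϑ θ t - levelPoint μ K e (φ + θ + t))) 0)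
    (iteratedDeriv k (fun t : ℝ => frameLevel μ K (pairSumPath μ K ρ ϑ θ t - levelPoint μ K 0 (φ + θ + t))) 0)
  have tri' := abs_sub_abs_le_abs_sub (iteratedDeriv k (fun t : ℝ => frameLevel μ K (pairSumPath μ K ρ ϑ θ t - levelPoint μ K 0 (φ + θ + t))) 0)
    (iteratedDeriv k (fun t : ℝ => frameLevel μ K (pairSumPath μ K 0 0 θ t - levelPoint μ K 0 (φ + θ + t))) 0)
  linarith

end Sizes

end Summit.HubbardSuperconductivity.HubbardSuperconductivity.Theorems.C4a

end
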